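import Summits.QuantumFields.YangMills.Theorems.AllWindowsColdBoxBoxMidWindowsSU22Crux
import HarnessLib

/-!
# Stub S1 `stub_boxDirichletDominationMidAbs : BoxDirichletDominationMidAbs` of LINE-18 «background-field hypercontractive expansion»
# — LANDED BY NAME (crux `AllWindowsColdBox.BulkMidWindowSU2`, stmt-QuantumFields-24006; skeleton v5 sha16 3c750a37, planner ym-idea-2 g14)

LINE-18's stub S1 is, verbatim, the TARGET of the sibling LINE-17 on ⟨stmt-QuantumFields-24003⟩ `BoxMidWindowsSU22`
(CLOSED·proved 2026-08-29T13:39Z): the absolute one-scale Dirichlet comparison of the cold-wall `SU(2)` box up to box exponent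
`1/16` at rate `β^{−9θ}`.  It is a tree theorem since ✓p721361 (`…AllWindowsColdBoxBoxMidLine.coreBound_holds`, the composition of
LINE-17's seven landed stubs A–G, and `…dominationMidAbs_of_coreBound`, the exponent bookkeeping `K⌈β^θ⌉⁶/β ≤ β^{−9θ}`).  This file
is pure bookkeeping: the registered Prop `BoxDirichletDominationMidAbs` is restated verbatim (LINE-17's `ρ₂` is the `abbrev` of
`fundamentalRep (Fin 2)`) and discharged by those two theorems.

HONEST LABEL: a registered obligation of one critic-PASSed line on the R2ξ″ RECORD-rung crux 24006 (shared with the closed crux 24003);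
no new mathematics; no crux, rung or summit is proved here; the Yang–Mills mass gap is NOT proved by this file.
-/

set_option autoImplicit false

noncomputable section

open Literature.MathematicalPhysics.QuantumLattice
open Summit.QuantumFields.YangMills.Theorems.WeakCouplingRates
open Summit.QuantumFields.YangMills.Theorems.AllWindowsColdBoxBoxMidLine (coreBound_holds dominationMidAbs_of_coreBound)

namespace Summit.QuantumFields.YangMills.Theorems.AllWindowsColdBoxBulkMidLine

/-- The registered stub statement `BoxDirichletDominationMidAbs` of LINE-18 (skeleton v5, sha16 3c750a37) on
`AllWindowsColdBox.BulkMidWindowSU2` (stmt-QuantumFields-24006), verbatim (it is also LINE-17's target on the closed crux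
stmt-QuantumFields-24003): for every box exponent `0 < θ ≤ 1/16`, eventually in `β`, for all separations `T ≤ ⌈β^θ⌉₊`,
`|β²·boxPlaqCov(SU(2), fund) β ⌈β^θ⌉₊ T − (3/4)·boxDirCircSqCov ⌈β^θ⌉₊ T| ≤ β^{−9θ}`; registered-stub copy, not a citable fact. -/
abbrev BoxDirichletDominationMidAbs : Prop :=
  ∀ θ : ℝ, 0 < θ → θ ≤ 1 / 16 → ∃ β₀ : ℝ, ∀ β : ℝ, β₀ ≤ β → ∀ T : ℕ, T ≤ ⌈β ^ θ⌉₊ →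
    |β ^ 2 * boxPlaqCov (fundamentalRep (Fin 2)) β ⌈β ^ θ⌉₊ T - 3 / 4 * boxDirCircSqCov ⌈β ^ θ⌉₊ T| ≤ β ^ (-(9 * θ))

/-- **STUB S1 of LINE-18 (stmt-QuantumFields-24006), by name and signature**: the absolute mid-window Dirichlet comparison holds —
LINE-17's `coreBound_holds` (stubs A–G) fed into its exponent bookkeeping `dominationMidAbs_of_coreBound` (both ✓p721361). -/
theorem stub_boxDirichletDominationMidAbs : BoxDirichletDominationMidAbs :=
  fun θ hθ hθ' => dominationMidAbs_of_coreBound θ hθ hθ' (coreBound_holds θ hθ hθ')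

end Summit.QuantumFields.YangMills.Theorems.AllWindowsColdBoxBulkMidLine

end
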